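import Summits.AtomisticToContinuum.Crystallization.Theorems.ChargedEnergyGapEikonalSplit
import HarnessLib

/-!
# Charged energy gap — NODE 113E «SphereCell»: confining the centre's unit direction to a cell of the sphere octant

Support file for `PricedLinkCensus.ChargedEnergyGap` (sub-problem `Crystallization` of `AtomisticToContinuum`); lens-3 g93, memo MUDIET-SPEC-g93 §7.2;
imports NODE 113D «EikonalSplit».

NODE 113D turns `‖u‖ = 1` at the centre into a three-way disjunction.  This file is the general form: let `t a := |u a|` for the centre's unit direction
`u`; then `t ∈ S²₊ := {t ≥ 0, t 0² + t 1² + t 2² = 1}`.  For a CELL `l ≤ t ≤ h` (six rationals) the centre rows give NINE linear rows in the station LP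
coordinates (chamber form, `ρ ∈ [ρ0, ρ1]`, `0 ≤ ρ0`): three LOWER-GAP rows `dt (a,T)² − dt 0² + 2·l_a·ρ0·dt 0 ≤ ρ1²` and six UPPER rows
`dt (a,b)² − dt 0² − 2·h_a·ρ1·dt 0 ≤ ρ1²` — the first upper bounds on how much deeper than the centre a neighbour may be (`centre_rows_of_cell`).  A finite
list of cells covering `S²₊` is certified by a kernel-decidable BSP of the cube `[0,1]³` (`CoverTree.check`, soundness `CoverTree.check_sound`), and
`sphere_cells_dispatch` hands the cover, for every chart-realisable chamber tuple, SOME cell whose nine rows hold — each cell being one station checked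
with 113D `StationCert.checkDX` and those rows as `extra`.
-/

namespace Summit.AtomisticToContinuum.Crystallization.Theorems.ChargedEnergyGapChartDial

open scoped Classical
open Literature.MathematicalPhysics.StatisticalMechanics Literature.Geometry.DiscreteGeometry
open Summit.AtomisticToContinuum.Crystallization.Theses.PricedLinkCensus
open Summit.AtomisticToContinuum.Crystallization.Theorems.ChargedEnergyGapNegative

/-! ## §113E.1 The nine rows of a cell -/
section Rows

/-- ★★★ **THE CELL ROWS**: if the centre's direction `u` (six centre rows) has `l a ≤ |u a| ≤ h a` on every axis, then in the chamber, with a positive tuple and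
`ρ0 ≤ ρ ≤ ρ1`, `0 ≤ ρ0`: the three lower-gap rows and the six upper rows hold. -/
theorem centre_rows_of_cell {ρ ρ0 ρ1 : ℝ} {dt : (Fin 3 → ℤ) → ℝ} {u : E3} (hrow : ∀ q ∈ stencil 0, realisRow ρ dt 0 q u)
    (h0 : ρ0 ≤ ρ) (h1 : ρ ≤ ρ1) (hρ0 : 0 ≤ ρ0) (hpos : ∀ p ∈ stencil 0, 0 < dt p)
    (hTF : ∀ a : Fin 3, dt (holeVertex 0 (a, true)) ≤ dt (holeVertex 0 (a, false)))
    (l h : Fin 3 → ℝ) (hl : ∀ a, 0 ≤ l a) (hmem : ∀ a, l a ≤ |u a| ∧ |u a| ≤ h a) :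
    (∀ a : Fin 3, dt (holeVertex 0 (a, true)) ^ 2 - dt 0 ^ 2 + 2 * l a * ρ0 * dt 0 ≤ ρ1 ^ 2) ∧
      ∀ (a : Fin 3) (b : Bool), dt (holeVertex 0 (a, b)) ^ 2 - dt 0 ^ 2 - 2 * h a * ρ1 * dt 0 ≤ ρ1 ^ 2 := by
  have hC : 0 ≤ dt 0 := (hpos 0 (mem_stencil_self 0)).le
  have hρ : 0 ≤ ρ := hρ0.trans h0
  have hρ1 : ρ ^ 2 ≤ ρ1 ^ 2 := pow_le_pow_left₀ hρ h1 2
  have hr : ∀ (a : Fin 3) (b : Bool), 2 * dt 0 * ρ * ((poleSign b : ℝ) * u a) ≤ ρ ^ 2 + dt 0 ^ 2 - dt (holeVertex 0 (a, b)) ^ 2 :=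
    fun a b => realisRow_centre_vertex a b (hrow _ (mem_stencil_vertex 0 (a, b)))
  have hdr : 0 ≤ 2 * dt 0 * ρ := by positivity
  refine ⟨fun a => ?_, fun a b => ?_⟩
  · -- lower gap on the T side
    have hT0 : 0 < dt (holeVertex 0 (a, true)) := hpos _ (mem_stencil_vertex 0 (a, true))
    have hsq : dt (holeVertex 0 (a, true)) ^ 2 ≤ dt (holeVertex 0 (a, false)) ^ 2 := pow_le_pow_left₀ hT0.le (hTF a) 2
    have hla := (hmem a).1
    have key : 2 * dt 0 * ρ * l a ≤ ρ ^ 2 + dt 0 ^ 2 - dt (holeVertex 0 (a, true)) ^ 2 := by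
      rcases le_or_gt 0 (u a) with hua | hua
      · have e := hr a true
        simp only [poleSign, if_true, Int.cast_one, one_mul] at e
        rw [abs_of_nonneg hua] at hla
        nlinarith [mul_le_mul_of_nonneg_left hla hdr]
      · have e := hr a false
        simp only [poleSign, Bool.false_eq_true, if_false, Int.cast_neg, Int.cast_one, neg_mul, one_mul] at e
        rw [abs_of_neg hua] at hla
        nlinarith [mul_le_mul_of_nonneg_left hla hdr]
    have hm : 2 * l a * ρ0 * dt 0 ≤ 2 * dt 0 * ρ * l a := by nlinarith [mul_nonneg (hl a) hC]
    linarith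
  · -- upper row towards (a, b)
    have hha : |u a| ≤ h a := (hmem a).2
    have hh0 : 0 ≤ h a := (abs_nonneg _).trans hha
    have hsgn : -(h a) ≤ (poleSign b : ℝ) * u a := by
      cases b
      · simp only [poleSign, Bool.false_eq_true, if_false, Int.cast_neg, Int.cast_one, neg_mul, one_mul]
        linarith [le_abs_self (u a)]
      · simp only [poleSign, if_true, Int.cast_one, one_mul]
        linarith [neg_abs_le (u a)]
    have e := hr a b
    have k1 : 2 * dt 0 * ρ * (-(h a)) ≤ 2 * dt 0 * ρ * ((poleSign b : ℝ) * u a) := mul_le_mul_of_nonneg_left hsgn hdr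
    have k2 : 2 * h a * ρ * dt 0 ≤ 2 * h a * ρ1 * dt 0 := by nlinarith [mul_nonneg hh0 hC]
    nlinarith

end Rows

/-! ## §113E.2 Cells and a kernel-decidable cover of the sphere octant -/
section Cover

/-- A box of `ℝ³` with rational corners (used both as a CELL and as a BSP node box). -/
structure Box3 where
  l0 : ℚ
  l1 : ℚ
  l2 : ℚ
  h0 : ℚ
  h1 : ℚ
  h2 : ℚ

/-- Lower corner as a function. -/
def Box3.lo (c : Box3) : Fin 3 → ℚ := fun a => if a = 0 then c.l0 else if a = 1 then c.l1 else c.l2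
/-- Upper corner as a function. -/
def Box3.hi (c : Box3) : Fin 3 → ℚ := fun a => if a = 0 then c.h0 else if a = 1 then c.h1 else c.h2

/-- [formal bookkeeping] -/
@[simp] theorem Box3.lo_zero (c : Box3) : c.lo 0 = c.l0 := rfl
/-- [formal bookkeeping] -/
@[simp] theorem Box3.lo_one (c : Box3) : c.lo 1 = c.l1 := rfl
/-- [formal bookkeeping] -/
@[simp] theorem Box3.lo_two (c : Box3) : c.lo 2 = c.l2 := rfl
/-- [formal bookkeeping] -/
@[simp] theorem Box3.hi_zero (c : Box3) : c.hi 0 = c.h0 := rfl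
/-- [formal bookkeeping] -/
@[simp] theorem Box3.hi_one (c : Box3) : c.hi 1 = c.h1 := rfl
/-- [formal bookkeeping] -/
@[simp] theorem Box3.hi_two (c : Box3) : c.hi 2 = c.h2 := rfl

/-- `B` is contained in the cell `c` (six comparisons). -/
def Box3.inside (B c : Box3) : Bool :=
  decide (c.l0 ≤ B.l0 ∧ c.l1 ≤ B.l1 ∧ c.l2 ≤ B.l2 ∧ B.h0 ≤ c.h0 ∧ B.h1 ≤ c.h1 ∧ B.h2 ≤ c.h2)

/-- `B` (with nonnegative lower corner) misses the unit sphere: its farthest corner is inside or its nearest corner is outside. -/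
def Box3.offSphere (B : Box3) : Bool :=
  decide (0 ≤ B.l0 ∧ 0 ≤ B.l1 ∧ 0 ≤ B.l2) &&
    (decide (0 ≤ B.h0 ∧ 0 ≤ B.h1 ∧ 0 ≤ B.h2 ∧ B.h0 ^ 2 + B.h1 ^ 2 + B.h2 ^ 2 < 1) || decide (1 < B.l0 ^ 2 + B.l1 ^ 2 + B.l2 ^ 2))

/-- Replace the upper (resp. lower) coordinate of axis `a` by `m`. -/
def Box3.setHi (B : Box3) (a : Fin 3) (m : ℚ) : Box3 :=
  if a = 0 then { B with h0 := m } else if a = 1 then { B with h1 := m } else { B with h2 := m }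
/-- Replace the lower coordinate of axis `a` by `m`. -/
def Box3.setLo (B : Box3) (a : Fin 3) (m : ℚ) : Box3 :=
  if a = 0 then { B with l0 := m } else if a = 1 then { B with l1 := m } else { B with l2 := m }

/-- A BSP certificate that a list of cells covers the part of the unit sphere inside a box. -/
inductive CoverTree where
  | cell (j : ℕ) : CoverTree
  | off : CoverTree
  | split (a : Fin 3) (m : ℚ) (left right : CoverTree) : CoverTree

/-- ★ THE COVER CHECKER: every leaf box lies in its named cell or misses the sphere. -/
def CoverTree.check (cells : List Box3) : CoverTree → Box3 → Bool
  | .cell j, B => match cells[j]? with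
    | some c => B.inside c
    | none => false
  | .off, B => B.offSphere
  | .split a m tl tr, B => CoverTree.check cells tl (B.setHi a m) && CoverTree.check cells tr (B.setLo a m)

/-- [formal bookkeeping] membership after cutting the upper coordinate. -/
theorem Box3.mem_setHi {B : Box3} {a : Fin 3} {m : ℚ} {t : Fin 3 → ℝ} (h : (∀ k : Fin 3, ((B).lo k : ℝ) ≤ t k ∧ t k ≤ (B).hi k)) (hm : t a ≤ m) :
    (∀ k : Fin 3, ((B.setHi a m).lo k : ℝ) ≤ t k ∧ t k ≤ (B.setHi a m).hi k) := by
  intro k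
  have hk := h k
  fin_cases a <;> fin_cases k <;> simp_all [Box3.setHi, Box3.lo, Box3.hi]

/-- [formal bookkeeping] membership after cutting the lower coordinate. -/
theorem Box3.mem_setLo {B : Box3} {a : Fin 3} {m : ℚ} {t : Fin 3 → ℝ} (h : (∀ k : Fin 3, ((B).lo k : ℝ) ≤ t k ∧ t k ≤ (B).hi k)) (hm : (m : ℝ) ≤ t a) :
    (∀ k : Fin 3, ((B.setLo a m).lo k : ℝ) ≤ t k ∧ t k ≤ (B.setLo a m).hi k) := by
  intro k
  have hk := h k
  fin_cases a <;> fin_cases k <;> simp_all [Box3.setLo, Box3.lo, Box3.hi]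

/-- [formal bookkeeping] `inside` is containment. -/
theorem Box3.mem_of_inside {B c : Box3} (h : B.inside c = true) {t : Fin 3 → ℝ} (ht : (∀ k : Fin 3, ((B).lo k : ℝ) ≤ t k ∧ t k ≤ (B).hi k)) :
    (∀ k : Fin 3, ((c).lo k : ℝ) ≤ t k ∧ t k ≤ (c).hi k) := by
  simp only [Box3.inside, decide_eq_true_eq] at h
  obtain ⟨a0, a1, a2, b0, b1, b2⟩ := h
  intro k
  have hk := ht k
  fin_cases k <;> simp_all [Box3.lo, Box3.hi] <;> constructor <;>
    first | exact le_trans (by exact_mod_cast a0) hk.1 | exact le_trans (by exact_mod_cast a1) hk.1 | exact le_trans (by exact_mod_cast a2) hk.1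
          | exact le_trans hk.2 (by exact_mod_cast b0) | exact le_trans hk.2 (by exact_mod_cast b1) | exact le_trans hk.2 (by exact_mod_cast b2)

/-- [formal bookkeeping] an off-sphere box contains no point of the sphere. -/
theorem Box3.not_mem_of_offSphere {B : Box3} (h : B.offSphere = true) {t : Fin 3 → ℝ} (ht : (∀ k : Fin 3, ((B).lo k : ℝ) ≤ t k ∧ t k ≤ (B).hi k))
    (hs : t 0 ^ 2 + t 1 ^ 2 + t 2 ^ 2 = 1) : False := by
  simp only [Box3.offSphere, Bool.and_eq_true, Bool.or_eq_true, decide_eq_true_eq] at h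
  obtain ⟨⟨p0, p1, p2⟩, h⟩ := h
  have m0 := ht 0; have m1 := ht 1; have m2 := ht 2
  simp only [Box3.lo_zero, Box3.lo_one, Box3.lo_two, Box3.hi_zero, Box3.hi_one, Box3.hi_two] at m0 m1 m2
  have q0 : (0 : ℝ) ≤ B.l0 := by exact_mod_cast p0
  have q1 : (0 : ℝ) ≤ B.l1 := by exact_mod_cast p1
  have q2 : (0 : ℝ) ≤ B.l2 := by exact_mod_cast p2
  rcases h with ⟨n0, n1, n2, hlt⟩ | hgt
  · have hlt' : (B.h0 : ℝ) ^ 2 + (B.h1 : ℝ) ^ 2 + (B.h2 : ℝ) ^ 2 < 1 := by exact_mod_cast hlt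
    have e0 : t 0 ^ 2 ≤ (B.h0 : ℝ) ^ 2 := pow_le_pow_left₀ (q0.trans m0.1) m0.2 2
    have e1 : t 1 ^ 2 ≤ (B.h1 : ℝ) ^ 2 := pow_le_pow_left₀ (q1.trans m1.1) m1.2 2
    have e2 : t 2 ^ 2 ≤ (B.h2 : ℝ) ^ 2 := pow_le_pow_left₀ (q2.trans m2.1) m2.2 2
    linarith
  · have hgt' : (1 : ℝ) < (B.l0 : ℝ) ^ 2 + (B.l1 : ℝ) ^ 2 + (B.l2 : ℝ) ^ 2 := by exact_mod_cast hgt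
    have e0 : (B.l0 : ℝ) ^ 2 ≤ t 0 ^ 2 := pow_le_pow_left₀ q0 m0.1 2
    have e1 : (B.l1 : ℝ) ^ 2 ≤ t 1 ^ 2 := pow_le_pow_left₀ q1 m1.1 2
    have e2 : (B.l2 : ℝ) ^ 2 ≤ t 2 ^ 2 := pow_le_pow_left₀ q2 m2.1 2
    linarith

/-- ★★ **SOUNDNESS OF THE COVER CHECKER**: a checked tree over the box `B` sends every sphere point of `B` into some listed cell. -/
theorem CoverTree.check_sound (cells : List Box3) : ∀ (T : CoverTree) (B : Box3), T.check cells B = true →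
    ∀ t : Fin 3 → ℝ, (∀ k : Fin 3, ((B).lo k : ℝ) ≤ t k ∧ t k ≤ (B).hi k) → t 0 ^ 2 + t 1 ^ 2 + t 2 ^ 2 = 1 →
      ∃ c ∈ cells, (∀ k : Fin 3, ((c).lo k : ℝ) ≤ t k ∧ t k ≤ (c).hi k)
  | .cell j, B, h, t, ht, _ => by
    simp only [CoverTree.check] at h
    cases hj : cells[j]? with
    | none => rw [hj] at h; exact absurd h (by simp)
    | some c => rw [hj] at h; exact ⟨c, List.mem_of_getElem? hj, Box3.mem_of_inside h ht⟩
  | .off, B, h, t, ht, hs => (Box3.not_mem_of_offSphere (by simpa [CoverTree.check] using h) ht hs).elim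
  | .split a m tl tr, B, h, t, ht, hs => by
    simp only [CoverTree.check, Bool.and_eq_true] at h
    rcases le_or_gt (t a) m with hle | hgt
    · exact CoverTree.check_sound cells tl _ h.1 t (Box3.mem_setHi ht hle) hs
    · exact CoverTree.check_sound cells tr _ h.2 t (Box3.mem_setLo ht hgt.le) hs

/-- The unit cube `[0,1]³`. -/
def unitCube : Box3 := ⟨0, 0, 0, 1, 1, 1⟩

/-- ★★★ **THE DISPATCH**: a list of cells with a checked cover of `S²₊ ∩ [0,1]³` hands every chart-realisable positive chamber tuple (with `ρ ∈ [ρ0, ρ1]`,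
`0 ≤ ρ0`) a cell whose NINE ROWS hold — the cover-level case split; each cell is one station certificate checked with 113D `checkDX`. -/
theorem sphere_cells_dispatch (cells : List Box3) (T : CoverTree) (hT : T.check cells unitCube = true)
    (hnn : cells.all (fun c => decide (0 ≤ c.l0 ∧ 0 ≤ c.l1 ∧ 0 ≤ c.l2)) = true)
    {ρ ρ0 ρ1 : ℝ} {dt : (Fin 3 → ℤ) → ℝ} (h : IsChartRealisable ρ dt) (h0 : ρ0 ≤ ρ) (h1 : ρ ≤ ρ1) (hρ0 : 0 ≤ ρ0)
    (hpos : ∀ p ∈ stencil 0, 0 < dt p) (hTF : ∀ a : Fin 3, dt (holeVertex 0 (a, true)) ≤ dt (holeVertex 0 (a, false))) :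
    ∃ c ∈ cells, (∀ a : Fin 3, dt (holeVertex 0 (a, true)) ^ 2 - dt 0 ^ 2 + 2 * (c.lo a : ℝ) * ρ0 * dt 0 ≤ ρ1 ^ 2) ∧
      ∀ (a : Fin 3) (b : Bool), dt (holeVertex 0 (a, b)) ^ 2 - dt 0 ^ 2 - 2 * (c.hi a : ℝ) * ρ1 * dt 0 ≤ ρ1 ^ 2 := by
  obtain ⟨u, hu, hrow⟩ := h 0 (mem_stencil_self 0)
  have hnorm : |u 0| ^ 2 + |u 1| ^ 2 + |u 2| ^ 2 = 1 := by
    have e := EuclideanSpace.real_norm_sq_eq u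
    rw [hu, Fin.sum_univ_three] at e
    simp only [one_pow] at e
    rw [sq_abs, sq_abs, sq_abs]
    linarith
  have hcube : ∀ k : Fin 3, ((unitCube).lo k : ℝ) ≤ |u k| ∧ |u k| ≤ (unitCube).hi k := by
    have hle : ∀ a : Fin 3, |u a| ≤ 1 := fun a => by
      have := sq_nonneg (|u 0|); have := sq_nonneg (|u 1|); have := sq_nonneg (|u 2|)
      have hsq : |u a| ^ 2 ≤ 1 := by fin_cases a <;> simp <;> nlinarith
      nlinarith [abs_nonneg (u a)]
    intro k
    fin_cases k <;> simp [unitCube, Box3.lo, Box3.hi, abs_nonneg, hle]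
  obtain ⟨c, hc, hmem⟩ := T.check_sound cells unitCube hT (fun a => |u a|) hcube hnorm
  have hl : ∀ a, (0 : ℝ) ≤ c.lo a := by
    have hc' := List.all_eq_true.mp hnn c hc
    simp only [decide_eq_true_eq] at hc'
    intro a
    fin_cases a
    · exact_mod_cast hc'.1
    · exact_mod_cast hc'.2.1
    · exact_mod_cast hc'.2.2
  exact ⟨c, hc, centre_rows_of_cell hrow h0 h1 hρ0 hpos hTF (fun a => (c.lo a : ℝ)) (fun a => (c.hi a : ℝ)) hl hmem⟩

end Cover

end Summit.AtomisticToContinuum.Crystallization.Theorems.ChargedEnergyGapChartDial
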